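import Literature.AlgebraicGeometry.Modules.PushforwardIsoAdjunction
import Literature.AlgebraicGeometry.Modules.SheafHomPushforward
import Literature.AlgebraicGeometry.Modules.SheafHomLeft
import Literature.AlgebraicGeometry.Modules.SheafHomFunctor
import Literature.AlgebraicGeometry.Modules.LocalFrames
import Literature.AlgebraicGeometry.Modules.VectorBundleFiniteLocallyFree
import Literature.AlgebraicGeometry.KTheory.PullbackVectorBundle
import HarnessLib

/-!
# Push-forward of `𝒪`-modules along an isomorphism of schemes: the unit, duals and the internal Hom

Layer `Literature/AlgebraicGeometry/Modules`; continuation of `PushforwardIsoAdjunction.lean` (`ε_*` is an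
equivalence for an isomorphism `ε : Y₀ ≅ Y₁`) and `SheafHomPushforward.lean`
(`ε_* 𝓗om(E, M) ≅ 𝓗om(ε_* E, ε_* M)`). Everything PROVED; no named facts, no new notion (only
comparison isomorphisms between existing objects).

* `unitPushforwardHom f : 𝒪_{Y₁} ⟶ f_* 𝒪_{Y₀}` (the map `f♯`, any `f`), an isomorphism
  `unitPushforwardIso ε : 𝒪_{Y₁} ≅ ε_* 𝒪_{Y₀}` for an isomorphism `ε` (sections `ε♯`, and the two
  round trips `app_unitPushforwardIso_inv_app`, `unitPushforwardIso_inv_app_app`);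
* `pullbackInvIsoPushforward ε E : (ε⁻¹)^* E ≅ ε_* E`, hence
  **`IsFiniteLocallyFree.pushforward_of_iso`**: `ε_* E` is finite locally free when `E` is;
* `dualPushforwardIso ε E : ε_* (E^∨) ≅ (ε_* E)^∨` and
  `sheafHomDualPushforwardIso ε E G : ε_* 𝓗om(E^∨, G) ≅ 𝓗om((ε_* E)^∨, ε_* G)`;
* naturality of the comparison `f_* 𝓗om(E, M) ⟶ 𝓗om(f_* E, f_* M)` in `M` (any `f`) and the natural
  isomorphism of functors `sheafHomFunctorCompPushforwardIso ε E : 𝓗om(E, –) ⋙ ε_* ≅ ε_* ⋙ 𝓗om(ε_* E, –)`;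
* `unitPushforwardIso_hom_comp_map_sheafHomUnit` — the unit `𝒪 → 𝓔nd(E)` commutes with `ε_*`;
* `pushforwardOverHom_comp'`, `pushforwardOverHom_overFunctor_map` (bookkeeping for `SheafHomPushforward`).

Motivation (venture HSemireg, bridge (B1), obligation (T-σ)): the transport of Buchweitz–Flenner
`I`-semiregularity (`HodgeTheory.IsISemiregular`, built from the trace with coefficients
`Extⁱ(E, 𝓗om(E^∨, G)) → Extⁱ(𝒪, G)`) along an isomorphism of the ambient scheme needs exactly these
compatibilities of `ε_*` with `𝒪`, `E^∨`, `𝓗om` and the unit; the contraction is treated in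
`PushforwardIsoContract.lean`.

References: R. Hartshorne, *Algebraic Geometry* (1977), II §5 pp. 109–110 (the sheaf Hom, direct and
inverse images), II Ex. 5.1 (duals of locally free sheaves); The Stacks project, Tag 01C8 (pull-back of
finite locally free modules). The statements are their bookkeeping along an isomorphism (reading; no
printed statement is typed verbatim). [Hartshorne1977] [StacksProject]
-/

noncomputable section

-- `TopCat.Presheaf`/`Scheme.Modules` are not reducible (as in Mathlib's `AlgebraicGeometry/Modules/Sheaf.lean`).
set_option backward.isDefEq.respectTransparency false

open CategoryTheory CategoryTheory.Limits AlgebraicGeometry Opposite TopologicalSpace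
open AlgebraicGeometry.Scheme.Modules

universe u

namespace Literature.AlgebraicGeometry.Modules

open Literature.AlgebraicGeometry.Motives

/-! ### The unit module along a morphism / an isomorphism -/

section Unit

variable {Y₀ Y₁ : Scheme.{u}} (f : Y₀ ⟶ Y₁)

/-- `f♯ : 𝒪_{Y₁} ⟶ f_* 𝒪_{Y₀}` as a morphism of `𝒪_{Y₁}`-modules (sections `a ↦ f♯ a`). [folklore] -/
def unitPushforwardHom : unitModule Y₁ ⟶ (pushforward f).obj (unitModule Y₀) where
  val := PresheafOfModules.homMk
    { app := fun U => AddCommGrpCat.ofHom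
        { toFun := fun a : Γ(Y₁, U.unop) => (f.app U.unop a : Γ(Y₀, f ⁻¹ᵁ U.unop))
          map_zero' := map_zero _
          map_add' := fun a b => map_add _ a b }
      naturality := fun {U V} i => by
        refine AddCommGrpCat.ext fun (a : Γ(Y₁, U.unop)) => ?_
        exact ConcreteCategory.congr_hom (f.naturality i) a }
    (fun U (r : Γ(Y₁, U.unop)) (a : Γ(Y₁, U.unop)) => by
      change f.app U.unop (r * a) = f.app U.unop r * f.app U.unop a
      exact map_mul _ r a)

/-- Sections of `unitPushforwardHom`: `a ↦ f♯ a`. [cite: Hartshorne1977, II §5 pp. 109–110 (the sheaf Hom and direct images f_*; reading: bookkeeping along an isomorphism of schemes)] -/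
@[simp]
theorem unitPushforwardHom_app_apply (U : Y₁.Opens) (a : Γ(Y₁, U)) :
    (unitPushforwardHom f).app U a = f.app U a := rfl

variable {f} (ε : Y₀ ≅ Y₁)

/-- For an isomorphism `ε`, `ε♯ : 𝒪_{Y₁} ⟶ ε_* 𝒪_{Y₀}` is an isomorphism. [folklore] -/
instance isIso_unitPushforwardHom : IsIso (unitPushforwardHom ε.hom) := by
  refine Scheme.Modules.Hom.isIso_iff_isIso_app.mpr fun U => ?_
  have : IsIso (ε.hom.app U) := inferInstance
  rw [ConcreteCategory.isIso_iff_bijective]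
  exact ConcreteCategory.bijective_of_isIso (ε.hom.app U)

/-- **`𝒪_{Y₁} ≅ ε_* 𝒪_{Y₀}`** for an isomorphism of schemes `ε` (sections: `ε♯`). [folklore] -/
def unitPushforwardIso : unitModule Y₁ ≅ (pushforward ε.hom).obj (unitModule Y₀) :=
  asIso (unitPushforwardHom ε.hom)

/-- `(unitPushforwardIso ε).hom = unitPushforwardHom ε.hom`. [cite: Hartshorne1977, II §5 pp. 109–110 (the sheaf Hom and direct images f_*; reading: bookkeeping along an isomorphism of schemes)] -/
@[simp]
theorem unitPushforwardIso_hom : (unitPushforwardIso ε).hom = unitPushforwardHom ε.hom := rfl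

/-- Sections of `unitPushforwardIso`: `a ↦ ε♯ a`. [cite: Hartshorne1977, II §5 pp. 109–110 (the sheaf Hom and direct images f_*; reading: bookkeeping along an isomorphism of schemes)] -/
theorem unitPushforwardIso_hom_app_apply (U : Y₁.Opens) (a : Γ(Y₁, U)) :
    (unitPushforwardIso ε).hom.app U a = ε.hom.app U a := rfl

/-- `ε♯ ((ε♯)⁻¹ r) = r` on sections. [cite: Hartshorne1977, II §5 pp. 109–110 (the sheaf Hom and direct images f_*; reading: bookkeeping along an isomorphism of schemes)] -/
theorem app_unitPushforwardIso_inv_app (V : Y₁.Opens) (r : Γ(Y₀, ε.hom ⁻¹ᵁ V)) :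
    ε.hom.app V ((unitPushforwardIso ε).inv.app V r) = r := by
  change ((unitPushforwardIso ε).inv ≫ (unitPushforwardIso ε).hom).app V r = r
  rw [Iso.inv_hom_id]
  rfl

/-- `(ε♯)⁻¹ (ε♯ a) = a` on sections. [cite: Hartshorne1977, II §5 pp. 109–110 (the sheaf Hom and direct images f_*; reading: bookkeeping along an isomorphism of schemes)] -/
theorem unitPushforwardIso_inv_app_app (V : Y₁.Opens) (a : Γ(Y₁, V)) :
    (unitPushforwardIso ε).inv.app V (ε.hom.app V a) = a := by
  change ((unitPushforwardIso ε).hom ≫ (unitPushforwardIso ε).inv).app V a = a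
  rw [Iso.hom_inv_id]
  rfl

end Unit

/-! ### `ε_* E` is finite locally free -/

section FLF

variable {Y₀ Y₁ : Scheme.{u}} (ε : Y₀ ≅ Y₁) (E : Y₀.Modules)

/-- `E ≅ ε⁻¹_* ε_* E`. [folklore] -/
def isoPushforwardInvPushforward : E ≅ (pushforward ε.inv).obj ((pushforward ε.hom).obj E) :=
  ((pushforwardId Y₀).app E).symm ≪≫ (pushforwardCongr ε.hom_inv_id).symm.app E ≪≫
    (pushforwardComp ε.hom ε.inv).symm.app E

/-- **`(ε⁻¹)^* E ≅ ε_* E`** for an isomorphism of schemes. [folklore] -/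
def pullbackInvIsoPushforward : (Scheme.Modules.pullback ε.inv).obj E ≅ (pushforward ε.hom).obj E :=
  pullbackIsoOfIsoPushforward ε.symm (isoPushforwardInvPushforward ε E)

/-- **The push-forward of a finite locally free module along an isomorphism is finite locally free.**
[cite: StacksProject, Tag 01C8] -/
theorem _root_.Literature.AlgebraicGeometry.Motives.IsFiniteLocallyFree.pushforward_of_iso
    {E : Y₀.Modules} (hE : IsFiniteLocallyFree E) :
    IsFiniteLocallyFree ((pushforward ε.hom).obj E) :=
  isFiniteLocallyFree_of_iso (pullbackInvIsoPushforward ε E) (hE.pullback ε.inv)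

end FLF

/-! ### Duals and `𝓗om(E^∨, –)` along `ε_*` -/

section Dual

variable {Y₀ Y₁ : Scheme.{u}} (ε : Y₀ ≅ Y₁) (E G : Y₀.Modules)

/-- **`ε_* (E^∨) ≅ (ε_* E)^∨`.** [folklore] -/
def dualPushforwardIso : (pushforward ε.hom).obj (dual E) ≅ dual ((pushforward ε.hom).obj E) :=
  sheafHomPushforwardIso ε E (unitModule Y₀) ≪≫
    (sheafHomFunctor ((pushforward ε.hom).obj E)).mapIso (unitPushforwardIso ε).symm

/-- **`ε_* 𝓗om(E^∨, G) ≅ 𝓗om((ε_* E)^∨, ε_* G)`.** [folklore] -/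
def sheafHomDualPushforwardIso :
    (pushforward ε.hom).obj (sheafHom (dual E) G) ≅
      sheafHom (dual ((pushforward ε.hom).obj E)) ((pushforward ε.hom).obj G) :=
  sheafHomPushforwardIso ε (dual E) G ≪≫ sheafHomMapLeftIso (dualPushforwardIso ε E) _

end Dual

/-! ### Naturality of `f_* 𝓗om(E, M) ⟶ 𝓗om(f_* E, f_* M)` in `M`; the unit of `𝓔nd` -/

section SheafHomNat

variable {Y₀ Y₁ : Scheme.{u}} (f : Y₀ ⟶ Y₁) (E : Y₀.Modules) {M N : Y₀.Modules}

/-- **Naturality of the comparison `f_* 𝓗om(E, M) ⟶ 𝓗om(f_* E, f_* M)` in `M`** (any morphism `f`).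
[cite: Hartshorne1977, II §5 pp. 109–110 (the sheaf Hom and direct images f_*; reading: bookkeeping along an isomorphism of schemes)] -/
theorem pushforward_map_sheafHomMap_comp_comparison (g : M ⟶ N) :
    (pushforward f).map (sheafHomMap E g) ≫ sheafHomPushforwardComparison f E N =
      sheafHomPushforwardComparison f E M ≫
        sheafHomMap ((pushforward f).obj E) ((pushforward f).map g) := by
  refine Scheme.Modules.hom_ext _ _ fun U => AddCommGrpCat.ext
    fun (φ₀ : E.over (f ⁻¹ᵁ U) ⟶ M.over (f ⁻¹ᵁ U)) => ?_
  change pushforwardOverHom f E N ((sheafHomMap E g).app (f ⁻¹ᵁ U) φ₀) =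
    (sheafHomMap ((pushforward f).obj E) ((pushforward f).map g)).app U (pushforwardOverHom f E M φ₀)
  rw [sheafHomMap_app_apply, sheafHomMap_app_apply]
  exact hom_ext_of_appLE fun _ _ _ => rfl

end SheafHomNat

section SheafHomNatIso

variable {Y₀ Y₁ : Scheme.{u}} (ε : Y₀ ≅ Y₁) (E : Y₀.Modules)

/-- **`𝓗om(E, –) ⋙ ε_* ≅ ε_* ⋙ 𝓗om(ε_* E, –)`** as functors `Y₀.Modules ⥤ Y₁.Modules`. [folklore] -/
def sheafHomFunctorCompPushforwardIso :
    sheafHomFunctor E ⋙ pushforward ε.hom ≅ pushforward ε.hom ⋙ sheafHomFunctor ((pushforward ε.hom).obj E) :=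
  NatIso.ofComponents (fun M => sheafHomPushforwardIso ε E M) fun {M N} g => by
    change (pushforward ε.hom).map (sheafHomMap E g) ≫ sheafHomPushforwardComparison ε.hom E N =
      sheafHomPushforwardComparison ε.hom E M ≫ sheafHomMap _ ((pushforward ε.hom).map g)
    exact pushforward_map_sheafHomMap_comp_comparison ε.hom E g

/-- **The unit `𝒪 → 𝓔nd(E)` along `ε_*`**: `ε♯ ≫ ε_*(u_E) ≫ (ε_*𝓔nd E ≅ 𝓔nd(ε_*E)) = u_{ε_*E}`.
[cite: Hartshorne1977, II §5 pp. 109–110 (the sheaf Hom and direct images f_*; reading: bookkeeping along an isomorphism of schemes)] -/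
theorem unitPushforwardIso_hom_comp_map_sheafHomUnit :
    (unitPushforwardIso ε).hom ≫ (pushforward ε.hom).map (sheafHomUnit E) ≫
        (sheafHomPushforwardIso ε E E).hom = sheafHomUnit ((pushforward ε.hom).obj E) := by
  refine Scheme.Modules.hom_ext _ _ fun U => AddCommGrpCat.ext fun (a : Γ(Y₁, U)) => ?_
  change pushforwardOverHom ε.hom E E ((sheafHomUnit E).app (ε.hom ⁻¹ᵁ U) (ε.hom.app U a)) =
    (sheafHomUnit ((pushforward ε.hom).obj E)).app U a
  rw [sheafHomUnit_app_apply, sheafHomUnit_app_apply]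
  refine hom_ext_of_appLE fun W k s => ?_
  rw [appLE_pushforwardOverHom, appLE_overScalar, appLE_overScalar]
  change Y₀.presheaf.map ((Opens.map ε.hom.base).map k).op (ε.hom.app U a) • (show Γ(E, ε.hom ⁻¹ᵁ W) from s) =
    ε.hom.app W (Y₁.presheaf.map k.op a) • (show Γ(E, ε.hom ⁻¹ᵁ W) from s)
  congr 1
  exact (ConcreteCategory.congr_hom (ε.hom.naturality k.op) a).symm

end SheafHomNatIso

/-! ### `pushforwardOverHom` and composition -/

section OverHom

variable {Y₀ Y₁ : Scheme.{u}} (f : Y₀ ⟶ Y₁)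

/-- `pushforwardOverHom` is compatible with composition. [cite: Hartshorne1977, II §5 pp. 109–110 (the sheaf Hom and direct images f_*; reading: bookkeeping along an isomorphism of schemes)] -/
theorem pushforwardOverHom_comp' {E M N : Y₀.Modules} {U : Y₁.Opens}
    (φ : E.over (f ⁻¹ᵁ U) ⟶ M.over (f ⁻¹ᵁ U)) (ψ : M.over (f ⁻¹ᵁ U) ⟶ N.over (f ⁻¹ᵁ U)) :
    pushforwardOverHom f E N (φ ≫ ψ) = pushforwardOverHom f E M φ ≫ pushforwardOverHom f M N ψ :=
  hom_ext_of_appLE fun _ _ _ => rfl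

/-- `pushforwardOverHom` of a restricted global morphism is the restricted pushed-forward morphism.
[cite: Hartshorne1977, II §5 pp. 109–110 (the sheaf Hom and direct images f_*; reading: bookkeeping along an isomorphism of schemes)] -/
theorem pushforwardOverHom_overFunctor_map {E M : Y₀.Modules} {U : Y₁.Opens} (φ : E ⟶ M) :
    pushforwardOverHom f E M ((SheafOfModules.overFunctor _ (f ⁻¹ᵁ U)).map φ) =
      (SheafOfModules.overFunctor _ U).map ((pushforward f).map φ) :=
  hom_ext_of_appLE fun _ _ _ => rfl

end OverHom

end Literature.AlgebraicGeometry.Modules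

end
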